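import Summits.Ventures.CertifiedManyBodySolver.Upper.GaugedShibaDWaveSourceOpenBox
import Summits.Ventures.CertifiedManyBodySolver.Upper.DWaveBoxPairWeightClosedForm
import HarnessLib

/-!
# The producers' transformed one-body matrix, entry by entry (the FORMAT-mpsgf1 `H̃` term table)

HONEST FRAMING: first certified bounds; not a superconductivity verdict. Nothing here is a number or a row.
`GaugedShibaDWaveSourceOpenBox.lean` gives the readers' operator `H̃ = S′ᴴ A_C S′ = dΓ(𝓗^ḡ) − μ·ab·1 + U(N↑ − Σ n↑n↓)`
for `S′ = partialParticleHole D↓ · orbitalPhase g`. Here we list the entries of `𝓗^ḡ_{ij} = ḡ_i g_j 𝓗_{ij}` for a SIGN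
gauge on the down orbitals (`g(x↑) = 1`, `g(x↓) = ε_x = ±1`; the tree's `spinSitePhase`) and then for the producers'
data on pin-1's open box (`τ = −[p∼q]`, `Δ = −h·w_C`, `ε_p = (−1)^{x+y}`): because the box is bipartite
(`boxStagger_mul_of_adj`: `ε_p ε_q = −1` on every bond) BOTH species hop with the uniform amplitude `−1`, the `a`-modes
carry `−μ`, the `b`-modes `+μ`, and the pair source has become the spin-flip hopping `2h·ε·w_C(p,q) = ±√2 h ε`
(`κ = √2 h` per bond) — the term classes an exact reader's `H̃` multiset is audited against (IRD desk leg M).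

* `gaugedNambuMatrix_orb_orb` (any `Λ`, any `τ, Δ, μ`, any sign function `ε`);
* `boxStagger_mul_of_adj`, `boxStagger_mul_self`, `star_dWaveBoxPairWeight`;
* **`producersNambuMatrix_orb_orb`** (the box table).
Written by the IRD desk (sr-mbsolver-ird-5).
-/

noncomputable section
namespace Summit.Ventures.CertifiedManyBodySolver
open Matrix Finset Literature.Probability.LatticeModels
open Literature.MathematicalPhysics.QuantumLattice Literature.Barriers.HubbardSuperconductivity HubbardWave0
open scoped ComplexOrder ComplexConjugate

section SignGauge

variable {Λ : Type*} [LinearOrder Λ] [Fintype Λ]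

omit [LinearOrder Λ] [Fintype Λ] in
/-- The sign gauge on the down orbitals: `g(x↑) = 1`. [folklore] -/
theorem spinSitePhase_sign_up (ε : Λ → ℂ) (x : Λ) :
    spinSitePhase (fun σ y => if σ = 1 then ε y else 1) (orb x 0) = 1 := by
  rw [spinSitePhase_orb, if_neg (by decide)]

omit [LinearOrder Λ] [Fintype Λ] in
/-- The sign gauge on the down orbitals: `g(x↓) = ε_x`. [folklore] -/
theorem spinSitePhase_sign_down (ε : Λ → ℂ) (x : Λ) :
    spinSitePhase (fun σ y => if σ = 1 then ε y else 1) (orb x 1) = ε x := by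
  rw [spinSitePhase_orb, if_pos rfl]

omit [LinearOrder Λ] [Fintype Λ] in
/-- A sign function has modulus one (so it is an admissible gauge). [folklore] -/
theorem norm_spinSitePhase_sign {ε : Λ → ℂ} (hε : ∀ x, ε x = 1 ∨ ε x = -1) (i : Orb Λ) :
    ‖spinSitePhase (fun σ y => if σ = 1 then ε y else 1) i‖ = 1 := by
  change ‖(if (ofLex i).2 = 1 then ε (ofLex i).1 else 1 : ℂ)‖ = 1
  split_ifs with h
  · rcases hε (ofLex i).1 with h1 | h1 <;> simp [h1]
  · simp

/-- **Entries of the sign-gauged Nambu matrix** `𝓗^ḡ_{ij} = ḡ_i g_j 𝓗_{ij}` (`𝓗 = bdgNambuMatrix τ Δ μ`, `g(x↑) = 1`,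
`g(x↓) = ε_x = ±1`): `↑↑: τ(x,y) − μδ_{xy}`, `↑↓: −ε_y (Δ(x,y)+Δ(y,x))^*`, `↓↑: −ε_x (Δ(x,y)+Δ(y,x))`,
`↓↓: ε_x ε_y (−τ(y,x) + μδ_{xy})`. [cite: BachLiebSolovej1994, §2] -/
theorem gaugedNambuMatrix_orb_orb (τ Δ : Λ → Λ → ℂ) (μ : ℝ) {ε : Λ → ℂ} (hε : ∀ x, ε x = 1 ∨ ε x = -1)
    (x y : Λ) (σ σ' : Fin 2) :
    (Matrix.of fun i j : Orb Λ =>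
        star (spinSitePhase (fun s z => if s = 1 then ε z else 1) i) *
          spinSitePhase (fun s z => if s = 1 then ε z else 1) j * bdgNambuMatrix τ Δ μ i j) (orb x σ) (orb y σ') =
      if σ = 0 then
        (if σ' = 0 then τ x y - (if x = y then (μ : ℂ) else 0) else -(ε y * star (Δ x y + Δ y x)))
      else
        (if σ' = 0 then -(ε x * (Δ x y + Δ y x)) else ε x * ε y * (-τ y x + (if x = y then (μ : ℂ) else 0))) := by
  have hstar : ∀ z, star (ε z) = ε z := fun z => by rcases hε z with h | h <;> simp [h]
  rw [Matrix.of_apply, bdgNambuMatrix_orb_orb]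
  fin_cases σ <;> fin_cases σ'
  · simp [spinSitePhase_sign_up]
  · simp [spinSitePhase_sign_up, spinSitePhase_sign_down]
    ring
  · simp [spinSitePhase_sign_up, spinSitePhase_sign_down, hstar]
    ring
  · simp [spinSitePhase_sign_down, hstar]

end SignGauge

section Box

variable (a b : ℕ)

/-- **The open box is bipartite for the staggered sign**: `ε_p ε_q = −1` on every bond of `rectBoxGraph a b`,
`ε_p = (−1)^{x+y}`. [folklore] -/
theorem boxStagger_mul_of_adj {p q : Fin a ×ₗ Fin b} (h : (rectBoxGraph a b).Adj p q) :
    (-1 : ℂ) ^ (((ofLex p).1 : ℕ) + ((ofLex p).2 : ℕ)) * (-1 : ℂ) ^ (((ofLex q).1 : ℕ) + ((ofLex q).2 : ℕ)) = -1 := by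
  rw [← pow_add]
  have hodd : Odd ((((ofLex p).1 : ℕ) + ((ofLex p).2 : ℕ)) + (((ofLex q).1 : ℕ) + ((ofLex q).2 : ℕ))) := by
    simp only [rectBoxGraph, lineAdj, Fin.ext_iff] at h
    rw [Nat.odd_iff]
    omega
  exact hodd.neg_one_pow

/-- `ε_p ε_p = 1`. [folklore] -/
theorem boxStagger_mul_self (p : Fin a ×ₗ Fin b) :
    (-1 : ℂ) ^ (((ofLex p).1 : ℕ) + ((ofLex p).2 : ℕ)) * (-1 : ℂ) ^ (((ofLex p).1 : ℕ) + ((ofLex p).2 : ℕ)) = 1 := by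
  rw [← pow_add, ← two_mul, pow_mul]
  norm_num

/-- The staggered sign is a sign. [folklore] -/
theorem boxStagger_eq_one_or (p : Fin a ×ₗ Fin b) :
    (-1 : ℂ) ^ (((ofLex p).1 : ℕ) + ((ofLex p).2 : ℕ)) = 1 ∨ (-1 : ℂ) ^ (((ofLex p).1 : ℕ) + ((ofLex p).2 : ℕ)) = -1 :=
  neg_one_pow_eq_or ℂ _

/-- The box pair weight is real. [folklore] -/
theorem star_dWaveBoxPairWeight (z : (Fin a ×ₗ Fin b) × (Fin a ×ₗ Fin b)) :
    star (dWaveBoxPairWeight a b z) = dWaveBoxPairWeight a b z := by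
  obtain ⟨p, q⟩ := z
  rw [dWaveBoxPairWeight_eq_closedForm]
  split_ifs <;> simp [Complex.conj_ofReal]

/-- **The producers' one-body table** (FORMAT-mpsgf1 §2 frame on pin-1's open box, `τ = −[p∼q]`, `Δ = −h·w_C`, sign
gauge `ε_p = (−1)^{x+y}` on the down orbitals): the gauged Nambu matrix has entries
`(p↑,q↑) = −[p∼q] − μδ_{pq}` (`a`-hopping `−1`, `a` on-site `−μ`), `(p↓,q↓) = −[p∼q] + μδ_{pq}` (`b`-hopping `−1` thanks to
`ε_pε_q = −1` on bonds, `b` on-site `+μ`), `(p↓,q↑) = 2h·ε_p·w_C(p,q)`, `(p↑,q↓) = 2h·ε_q·w_C(p,q)` (spin-flip hopping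
`±√2·h·ε` on bonds). With `gaugedShiba'_conjTranspose_conj_dWaveSourceOpenBox`, `H̃ = dΓ(this) − μ·ab·1 + U(N_a − Σ n^a n^b)`.
[cite: Lieb1989, proof of Theorem 2] -/
theorem producersNambuMatrix_orb_orb (μ h : ℝ) (p q : Fin a ×ₗ Fin b) (σ σ' : Fin 2) :
    (Matrix.of fun i j : Orb (Fin a ×ₗ Fin b) =>
        star (spinSitePhase (fun s z => if s = 1 then (-1 : ℂ) ^ (((ofLex z).1 : ℕ) + ((ofLex z).2 : ℕ)) else 1) i) *
          spinSitePhase (fun s z => if s = 1 then (-1 : ℂ) ^ (((ofLex z).1 : ℕ) + ((ofLex z).2 : ℕ)) else 1) j *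
          bdgNambuMatrix
            (fun x y : Fin a ×ₗ Fin b => if (rectBoxGraph a b).Adj x y then -(1 : ℂ) else 0)
            (fun u v : Fin a ×ₗ Fin b => -(h : ℂ) * dWaveBoxPairWeight a b (u, v)) μ i j) (orb p σ) (orb q σ') =
      if σ = 0 then
        (if σ' = 0 then -(if (rectBoxGraph a b).Adj p q then (1 : ℂ) else 0) - (if p = q then (μ : ℂ) else 0)
         else 2 * (h : ℂ) * (-1 : ℂ) ^ (((ofLex q).1 : ℕ) + ((ofLex q).2 : ℕ)) * dWaveBoxPairWeight a b (p, q))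
      else
        (if σ' = 0 then 2 * (h : ℂ) * (-1 : ℂ) ^ (((ofLex p).1 : ℕ) + ((ofLex p).2 : ℕ)) * dWaveBoxPairWeight a b (p, q)
         else -(if (rectBoxGraph a b).Adj p q then (1 : ℂ) else 0) + (if p = q then (μ : ℂ) else 0)) := by
  rw [gaugedNambuMatrix_orb_orb _ _ μ (boxStagger_eq_one_or a b) p q σ σ']
  have hw : dWaveBoxPairWeight a b (q, p) = dWaveBoxPairWeight a b (p, q) := (dWaveBoxPairWeight_symm a b p q).symm
  by_cases hσ : σ = 0 <;> by_cases hσ' : σ' = 0 <;> simp only [hσ, hσ', if_true, if_false]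
  · -- `a`-modes: hopping `-1`, on-site `-μ`
    split_ifs <;> ring
  · -- `(p↑, q↓)`: spin-flip hopping `2h ε_q w_C(p,q)`
    rw [hw, star_add, star_mul, star_neg, star_dWaveBoxPairWeight, Complex.star_def, Complex.conj_ofReal]
    ring
  · -- `(p↓, q↑)`
    rw [hw]
    ring
  · -- `b`-modes: hopping `-1` by bipartiteness, on-site `+μ`
    by_cases hpq : p = q
    · subst hpq
      rw [if_neg (rectBoxGraph a b).irrefl, if_neg (rectBoxGraph a b).irrefl, if_pos rfl, boxStagger_mul_self]
      ring
    · by_cases hadj : (rectBoxGraph a b).Adj p q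
      · rw [if_pos hadj, if_pos hadj.symm, if_neg hpq, boxStagger_mul_of_adj a b hadj]
        ring
      · rw [if_neg hadj, if_neg (fun h' => hadj h'.symm), if_neg hpq]
        ring

end Box
end Summit.Ventures.CertifiedManyBodySolver
end
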